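import Mathlib.Combinatorics.SetFamily.Compression.Down
import Mathlib.Tactic
import HarnessLib
import HarnessLib.Audit.Tags
import Summits.CriticalPhenomena.PercolationContinuityZ3.Theorems.PercNearOneGluingNoHeavyLowerTailSahiRainbowStrictCompress

/-!
# The rainbow lemma: the STRICT form for non-degenerate families, and the reduction to the fully pinned residual

Support file (seat `prim-masterthm-p1`, gen 40; `--supports stmt-CriticalPhenomena-4575`).  THIS FILE: the two compression theorems and the reduction
(definitions in `…SahiRainbowStrictDefs`, compression lemmas in `…SahiRainbowStrictCompress`); pure theorems, no `sorry`, standard axioms.  Memo `run/shared/lean/prim/prim-masterthm/FROM-prim-masterthm-p1-g40-STRICT-RAINBOW.md`.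

SETTING (`…SahiPartitionDaykin`, `…SahiPartitionDaykinCredit`): `𝒜 ⊆ 2^F` complement-free, `rainbowMeets F 𝒜 = {∅} ∪ {a ∩ b, F \ (a ∪ b) : a ≠ b}`;
the RAINBOW LEMMA `RainbowMeetCojoin` (OPEN) asks `#𝒜 ≤ #rainbowMeets F 𝒜`.  Gen 33 proved the CREDIT LEMMA for compression at a point `r`
(`card_rainbowMeets_compress`: with `𝔅 = 𝒜.memberSubfamily r ∪ 𝒜.nonMemberSubfamily r` the projections and `𝔄 = 𝒜.memberSubfamily r ∩
𝒜.nonMemberSubfamily r` the doubled members, `#rainbowMeets (F.erase r) 𝔅 + #posRainbow (F.erase r) 𝔄 ≤ #rainbowMeets F 𝒜`) and identified the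
two kinds of BAD points blocking the induction: (α) `𝔅` not complement-free (a NEAR-COMPLEMENTARY pair at `r`: two members `a, b` with `a ∩ b ⊆ {r}`,
`F.erase r ⊆ a ∪ b`), and (β) `𝔄 ≠ ∅` pairwise intersecting and non-covering with `{r}` not a colour (then `#posRainbow 𝔄` may be `#𝔄 − 1`).

NEW HERE ([this work], gen 40).  Call `𝒜` DEGENERATE if two distinct members are disjoint or cover `F` (equivalently `∅ ∈ posRainbow F 𝒜`).
STRENGTHENED STATEMENT `RainbowStrictOn F`: every complement-free `𝒞 ⊆ 2^F` has `#𝒞 ≤ #rainbowMeets F 𝒞`, and `#𝒞 + 1 ≤ #rainbowMeets F 𝒞` if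
`𝒞` is NON-degenerate with `#𝒞 ≥ 2`.  EVIDENCE: true for every complement-free family of `2^n`, `n ≤ 5` (43 046 688 families of `2^5`; engines
`prim-masterthm-p1/code-g40/c/rbplus.c`) and for `1.47·10⁶` random complement-free families of `2^6` (`step6.c`), 0 failures; the 260 tight
families of `2^5` are all degenerate.  With the strict form as inductive hypothesis, bad points of type (β) DISAPPEAR:
* `card_add_one_le_card_rainbowMeets_of_not_degenerate` — if `RainbowStrictOn (F.erase r)` holds for SOME `r ∈ F`, then every non-degenerate
  complement-free `𝒜 ⊆ 2^F` with `#𝒜 ≥ 2` has `#𝒜 + 1 ≤ #rainbowMeets F 𝒜` (for non-degenerate `𝒜`, `𝔅` is automatically complement-free, `𝔄` is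
  non-degenerate so the hypothesis repays the doubled members in full, a third member supplies a non-empty twin colour, and a degenerate `𝔅`
  supplies the twin `∅`/`{r}`): the strict form PROPAGATES through compression at ANY point;
* `card_le_card_rainbowMeets_of_unpinned` — if `RainbowStrictOn (F.erase r)` and `𝔅` is complement-free (no near-complementary pair at `r`), then
  `#𝒜 ≤ #rainbowMeets F 𝒜`, with no condition on the doubled members;
* `rainbowStrictOn_of_residual`, `rainbowMeetCojoin_of_residual` — consequently the rainbow lemma AND its strict form for all families follow from
  the weak inequality for the RESIDUAL class: degenerate complement-free families that are FULLY PINNED (a near-complementary pair at EVERY point of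
  `F`), given the statement on all smaller ground sets.  For such families every singleton is a colour (`singleton_mem_rainbowMeets_of_pinned`).
  CENSUS of the residual (`frpin.c`, adding "every member redundant", which member deletion also allows): none on `2^≤2`; on `2^3` exactly the two
  tight quadruples `{∅,01,02,12}`, `{F,0,1,2}`; on `2^4` 16 families (N = 8, slack 3); on `2^5` 4 370 families, minimum slack 3; and the
  compression count closes with the full bookkeeping (all extra colours and twins) at EVERY point of EVERY complement-free family of `2^≤5` and of
  all sampled families of `2^6` (`step.c`, `step2.c`, `step6.c`).
HONEST FRAMING: `RainbowMeetCojoin` and `RainbowStrict` remain OPEN; the theorems are unconditional reductions. [this work]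
-/

namespace Summit.CriticalPhenomena.PercolationContinuityZ3.Theorems.SahiColouredDaykin

open Finset

variable {α : Type*} [DecidableEq α]

/-! ### 1. Pinned points see singletons -/

section Pinned

variable {F : Finset α} {𝒜 : Finset (Finset α)} {r : α}

/-- **Pinned points give singleton colours.**  If `𝒜 ⊆ 2^F` (complement-free, at least two members) has a near-complementary pair at `r`
(the projected family `𝔅` is not complement-free), then `{r}` is a rainbow meet of `𝒜`. [this work] -/
theorem singleton_mem_rainbowMeets_of_pinned (hr : r ∈ F) (h𝒜F : ∀ a ∈ 𝒜, a ⊆ F) (hcf : ∀ a ∈ 𝒜, F \ a ∉ 𝒜) (h2 : 2 ≤ #𝒜)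
    (hpin : ¬ ∀ b ∈ 𝒜.memberSubfamily r ∪ 𝒜.nonMemberSubfamily r,
      (F.erase r) \ b ∉ 𝒜.memberSubfamily r ∪ 𝒜.nonMemberSubfamily r) :
    ({r} : Finset α) ∈ rainbowMeets F 𝒜 := by
  push Not at hpin
  obtain ⟨b, hb, hb'⟩ := hpin
  obtain ⟨a, ha, a', ha', haa, hdisj, hcov⟩ := exists_near_compl_pair hr h𝒜F hcf h2 hb hb'
  rcases subset_singleton_iff.1 hdisj with h0 | h1
  · rcases subset_singleton_iff.1 hcov with h0' | h1'
    · -- disjoint and covering: a complementary pair inside `𝒜`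
      exfalso
      apply hcf a ha
      have e : F \ a = a' := by
        ext t; simp only [mem_sdiff]
        constructor
        · rintro ⟨htF, hta⟩
          by_contra hta'
          have : t ∈ F \ (a ∪ a') := mem_sdiff.2 ⟨htF, fun h => (mem_union.1 h).elim hta hta'⟩
          rw [h0'] at this; exact notMem_empty t this
        · intro hta'
          refine ⟨h𝒜F a' ha' hta', fun hta => ?_⟩
          have : t ∈ a ∩ a' := mem_inter.2 ⟨hta, hta'⟩
          rw [h0] at this; exact notMem_empty t this
      rw [e]; exact ha'
    · rw [← h1']; exact sdiff_union_mem_rainbowMeets ha ha' haa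
  · rw [← h1]; exact inter_mem_rainbowMeets ha ha' haa

/-- **Fully pinned families see every singleton.**  If every point of `F` is pinned then all singletons and `∅` are rainbow meets, so
`#F + 1 ≤ #rainbowMeets F 𝒜`. [this work] -/
theorem card_add_one_le_card_rainbowMeets_of_fully_pinned (h𝒜F : ∀ a ∈ 𝒜, a ⊆ F) (hcf : ∀ a ∈ 𝒜, F \ a ∉ 𝒜) (h2 : 2 ≤ #𝒜)
    (hpin : ∀ r ∈ F, ¬ ∀ b ∈ 𝒜.memberSubfamily r ∪ 𝒜.nonMemberSubfamily r,
      (F.erase r) \ b ∉ 𝒜.memberSubfamily r ∪ 𝒜.nonMemberSubfamily r) :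
    #F + 1 ≤ #(rainbowMeets F 𝒜) := by
  have hsub : insert ∅ (F.image fun r => ({r} : Finset α)) ⊆ rainbowMeets F 𝒜 := by
    intro Z hZ
    rcases mem_insert.1 hZ with rfl | hZ
    · exact mem_rainbowMeets_iff.2 (Or.inl rfl)
    · obtain ⟨r, hr, rfl⟩ := mem_image.1 hZ
      exact singleton_mem_rainbowMeets_of_pinned hr h𝒜F hcf h2 (hpin r hr)
  have hinj : Set.InjOn (fun r => ({r} : Finset α)) F := fun x _ y _ h => singleton_injective h
  have h0 : (∅ : Finset α) ∉ F.image fun r => ({r} : Finset α) := by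
    intro h; obtain ⟨r, _, hr⟩ := mem_image.1 h; exact singleton_ne_empty r hr
  calc #F + 1 = #(insert ∅ (F.image fun r => ({r} : Finset α))) := by rw [card_insert_of_notMem h0, card_image_of_injOn hinj]
    _ ≤ #(rainbowMeets F 𝒜) := card_le_card hsub

end Pinned

/-! ### 2. The two compression theorems -/

section Main

variable {F : Finset α} {𝒜 : Finset (Finset α)} {r : α}

/-- A third member besides the doubled pair `x, insert r x`. [this work] -/
theorem exists_third_member {x : Finset α} (h3 : 3 ≤ #𝒜) : ∃ p ∈ 𝒜, p ≠ x ∧ p ≠ insert r x := by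
  have h1 : 1 ≤ #((𝒜.erase x).erase (insert r x)) := by
    have e1 := pred_card_le_card_erase (s := 𝒜) (a := x)
    have e2 := pred_card_le_card_erase (s := 𝒜.erase x) (a := insert r x)
    omega
  obtain ⟨p, hp⟩ := card_pos.1 h1
  obtain ⟨hp1, hp2⟩ := mem_erase.1 hp
  obtain ⟨hp3, hp4⟩ := mem_erase.1 hp2
  exact ⟨p, hp4, hp3, hp1⟩

/-- **Compression at an UNPINNED point (weak form).**  If the strengthened rainbow statement holds inside `F.erase r` and the projected
family `𝔅` is complement-free there (no near-complementary pair of `𝒜` at `r`), then `#𝒜 ≤ #rainbowMeets F 𝒜` — whatever the doubled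
members are: a non-degenerate doubled family is repaid in full by the STRICT hypothesis, a degenerate one by the weak hypothesis, and a
single doubled member by a third-member twin. [this work] -/
theorem card_le_card_rainbowMeets_of_unpinned (hr : r ∈ F) (h𝒜F : ∀ a ∈ 𝒜, a ⊆ F) (hcf : ∀ a ∈ 𝒜, F \ a ∉ 𝒜)
    (h𝔅 : ∀ b ∈ 𝒜.memberSubfamily r ∪ 𝒜.nonMemberSubfamily r,
      (F.erase r) \ b ∉ 𝒜.memberSubfamily r ∪ 𝒜.nonMemberSubfamily r)
    (IH : RainbowStrictOn (F.erase r)) : #𝒜 ≤ #(rainbowMeets F 𝒜) := by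
  set M := 𝒜.memberSubfamily r with hM
  set N := 𝒜.nonMemberSubfamily r with hN
  set L := rainbowMeets F 𝒜 with hL
  have hsum : #(M ∪ N) + #(M ∩ N) = #𝒜 := card_compress_add_card_doubled 𝒜 r
  have h𝔅F : ∀ b ∈ M ∪ N, b ⊆ F.erase r := fun b hb => subset_erase_of_mem_compress h𝒜F hb
  have h𝔄F : ∀ b ∈ M ∩ N, b ⊆ F.erase r := fun b hb => h𝔅F b (mem_union_left _ (mem_inter.1 hb).1)
  have hcf𝔄 := compl_free_doubled (𝒜 := 𝒜) hr hcf
  have IHB := (IH (M ∪ N) h𝔅F h𝔅).1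
  have c0 := card_compress_add_card_twins_le F 𝒜 r ∅ (empty_subset _)
  rw [← hM, ← hN, ← hL, card_empty] at c0
  rcases Nat.lt_or_ge #(M ∩ N) 2 with hk | hk
  · rcases Nat.lt_or_ge #(M ∩ N) 1 with hk0 | hk1
    · -- no doubled member
      have : #(M ∩ N) = 0 := by omega
      omega
    · -- exactly one doubled member `x`
      have hk1' : #(M ∩ N) = 1 := by omega
      obtain ⟨x, hx⟩ := card_eq_one.1 hk1'
      have hxA : x ∈ M ∩ N := by rw [hx]; exact mem_singleton_self x
      obtain ⟨hxM, hxN⟩ := mem_inter.1 hxA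
      have hx𝒜 : x ∈ 𝒜 := (mem_nonMemberSubfamily.1 hxN).1
      have hrx : r ∉ x := (mem_nonMemberSubfamily.1 hxN).2
      have hx' : insert r x ∈ 𝒜 := (mem_memberSubfamily.1 hxM).1
      have hxx' : x ≠ insert r x := fun e => hrx (e.symm ▸ mem_insert_self r x)
      by_cases h3 : 3 ≤ #𝒜
      · obtain ⟨p, hp, hpx, hpx'⟩ := exists_third_member (r := r) h3
        obtain ⟨W, hW, _⟩ := exists_twin_of_doubled_of_third F 𝒜 r hr hxA hp hpx hpx'
        have c1 := card_compress_add_card_twins_le F 𝒜 r {W} (singleton_subset_iff.2 hW)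
        rw [← hM, ← hN, ← hL, card_singleton] at c1
        omega
      · -- `𝒜 = {x, insert r x}`: two colours `∅` and `x` (or `F.erase r` if `x = ∅`)
        have h2 : 2 ≤ #𝒜 := by
          have := one_lt_card.2 ⟨x, hx𝒜, insert r x, hx', hxx'⟩; omega
        have hxL : x ∈ L := by
          have := inter_mem_rainbowMeets (F := F) hx𝒜 hx' hxx'
          rwa [inter_eq_left.2 (subset_insert r x)] at this
        have hcL : F \ insert r x ∈ L := by
          have := sdiff_union_mem_rainbowMeets (F := F) hx𝒜 hx' hxx'
          rwa [union_eq_right.2 (subset_insert r x)] at this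
        have h0L : (∅ : Finset α) ∈ L := mem_rainbowMeets_iff.2 (Or.inl rfl)
        have two : 1 < #L := by
          by_cases hx0 : x = ∅
          · refine one_lt_card.2 ⟨∅, h0L, F \ insert r x, hcL, fun e => ?_⟩
            have hne := erase_nonempty_of_two_le_card hr h𝒜F hcf h2
            rw [hx0, insert_empty_eq, sdiff_singleton_eq_erase] at e
            exact hne.ne_empty e.symm
          · exact one_lt_card.2 ⟨∅, h0L, x, hxL, fun e => hx0 e.symm⟩
        omega
  · -- at least two doubled members: the hypothesis repays them in full
    have IHA := IH (M ∩ N) h𝔄F hcf𝔄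
    have hkP : #(M ∩ N) ≤ #(posRainbow (F.erase r) (M ∩ N)) := by
      by_cases hd : RainbowDegenerate (F.erase r) (M ∩ N)
      · have := IHA.1; rw [card_rainbowMeets_of_degenerate hd] at this; exact this
      · have := IHA.2 hk hd; rw [card_rainbowMeets_of_not_degenerate hd] at this; omega
    have c1 := card_compress_add_card_twins_le F 𝒜 r _ (posRainbow_doubled_subset_twins F 𝒜 r hr)
    rw [← hM, ← hN, ← hL] at c1
    omega

/-- **Compression at ANY point for NON-DEGENERATE families (strict form).**  If the strengthened rainbow statement holds inside `F.erase r`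
for some `r ∈ F`, then every non-degenerate complement-free `𝒜 ⊆ 2^F` with at least two members has `#𝒜 + 1 ≤ #rainbowMeets F 𝒜`: the
strict inequality propagates.  (No point of a non-degenerate family is pinned; the doubled family is non-degenerate, so the strict hypothesis
repays it in full; a third member gives a NON-EMPTY twin; and if the projected family is degenerate then `{r}` is a colour and `∅` a twin.)
[this work] -/
theorem card_add_one_le_card_rainbowMeets_of_not_degenerate (hr : r ∈ F) (h𝒜F : ∀ a ∈ 𝒜, a ⊆ F) (hcf : ∀ a ∈ 𝒜, F \ a ∉ 𝒜)
    (h2 : 2 ≤ #𝒜) (hnd : ¬ RainbowDegenerate F 𝒜) (IH : RainbowStrictOn (F.erase r)) : #𝒜 + 1 ≤ #(rainbowMeets F 𝒜) := by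
  set M := 𝒜.memberSubfamily r with hM
  set N := 𝒜.nonMemberSubfamily r with hN
  set L := rainbowMeets F 𝒜 with hL
  have h𝔅 := compl_free_compress_of_not_degenerate (𝒜 := 𝒜) hr h𝒜F hcf h2 hnd
  have hsum : #(M ∪ N) + #(M ∩ N) = #𝒜 := card_compress_add_card_doubled 𝒜 r
  have h𝔅F : ∀ b ∈ M ∪ N, b ⊆ F.erase r := fun b hb => subset_erase_of_mem_compress h𝒜F hb
  have h𝔄F : ∀ b ∈ M ∩ N, b ⊆ F.erase r := fun b hb => h𝔅F b (mem_union_left _ (mem_inter.1 hb).1)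
  have hcf𝔄 := compl_free_doubled (𝒜 := 𝒜) hr hcf
  have IHB := IH (M ∪ N) h𝔅F h𝔅
  have hAB : #(M ∩ N) ≤ #(M ∪ N) := card_le_card (fun x hx => mem_union_left _ (mem_inter.1 hx).1)
  -- the twin `∅` when the projected family is degenerate
  have twin0 : RainbowDegenerate (F.erase r) (M ∪ N) → (∅ : Finset α) ∈ L.memberSubfamily r ∩ L.nonMemberSubfamily r :=
    fun hd => empty_mem_twins_of_singleton_mem F 𝒜 r (singleton_mem_rainbowMeets_of_degenerate_compress hnd hd)
  rcases Nat.lt_or_ge #(M ∩ N) 2 with hk | hk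
  · rcases Nat.lt_or_ge #(M ∩ N) 1 with hk0 | hk1
    · -- no doubled member: `#𝒜 = #𝔅`
      have hk0' : #(M ∩ N) = 0 := by omega
      have hB2 : 2 ≤ #(M ∪ N) := by omega
      by_cases hd : RainbowDegenerate (F.erase r) (M ∪ N)
      · have c1 := card_compress_add_card_twins_le F 𝒜 r {∅} (singleton_subset_iff.2 (twin0 hd))
        rw [← hM, ← hN, ← hL, card_singleton] at c1
        have := IHB.1; omega
      · have c0 := card_compress_add_card_twins_le F 𝒜 r ∅ (empty_subset _)
        rw [← hM, ← hN, ← hL, card_empty] at c0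
        have := IHB.2 hB2 hd; omega
    · -- exactly one doubled member `x`
      have hk1' : #(M ∩ N) = 1 := by omega
      obtain ⟨x, hx⟩ := card_eq_one.1 hk1'
      have hxA : x ∈ M ∩ N := by rw [hx]; exact mem_singleton_self x
      obtain ⟨hxM, hxN⟩ := mem_inter.1 hxA
      have hx𝒜 : x ∈ 𝒜 := (mem_nonMemberSubfamily.1 hxN).1
      have hrx : r ∉ x := (mem_nonMemberSubfamily.1 hxN).2
      have hx' : insert r x ∈ 𝒜 := (mem_memberSubfamily.1 hxM).1
      have hxx' : x ≠ insert r x := fun e => hrx (e.symm ▸ mem_insert_self r x)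
      by_cases h3 : 3 ≤ #𝒜
      · obtain ⟨p, hp, hpx, hpx'⟩ := exists_third_member (r := r) h3
        obtain ⟨W, hW, hWform⟩ := exists_twin_of_doubled_of_third F 𝒜 r hr hxA hp hpx hpx'
        have hW0 : W ≠ ∅ := by
          rcases hWform with ⟨rfl, _⟩ | ⟨rfl, hrp⟩
          · exact fun e => hnd (degenerate_of_inter_eq_empty hx𝒜 hp (fun h => hpx h.symm) e)
          · exact fun e => hnd (degenerate_of_sdiff_union_eq_empty hx' hp (fun h => hpx' h.symm) e)
        have hB2 : 2 ≤ #(M ∪ N) := by omega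
        by_cases hd : RainbowDegenerate (F.erase r) (M ∪ N)
        · have hE : ({∅, W} : Finset (Finset α)) ⊆ L.memberSubfamily r ∩ L.nonMemberSubfamily r := by
            intro Z hZ
            rcases mem_insert.1 hZ with rfl | hZ
            · exact twin0 hd
            · rw [mem_singleton.1 hZ]; exact hW
          have c1 := card_compress_add_card_twins_le F 𝒜 r {∅, W} hE
          rw [← hM, ← hN, ← hL, card_pair (fun e => hW0 e.symm)] at c1
          have := IHB.1; omega
        · have c1 := card_compress_add_card_twins_le F 𝒜 r {W} (singleton_subset_iff.2 hW)
          rw [← hM, ← hN, ← hL, card_singleton] at c1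
          have := IHB.2 hB2 hd; omega
      · -- `𝒜 = {x, insert r x}`: the three colours `∅`, `x`, `F \ insert r x` are distinct
        have hxL : x ∈ L := by
          have := inter_mem_rainbowMeets (F := F) hx𝒜 hx' hxx'
          rwa [inter_eq_left.2 (subset_insert r x)] at this
        have hcL : F \ insert r x ∈ L := by
          have := sdiff_union_mem_rainbowMeets (F := F) hx𝒜 hx' hxx'
          rwa [union_eq_right.2 (subset_insert r x)] at this
        have h0L : (∅ : Finset α) ∈ L := mem_rainbowMeets_iff.2 (Or.inl rfl)
        have hx0 : x ≠ ∅ := by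
          intro e
          apply hnd (degenerate_of_inter_eq_empty hx𝒜 hx' hxx' ?_)
          rw [e, empty_inter]
        have hc0 : F \ insert r x ≠ ∅ := by
          intro e
          apply hnd (degenerate_of_sdiff_union_eq_empty hx𝒜 hx' hxx' ?_)
          rwa [union_eq_right.2 (subset_insert r x)]
        have hxc : x ≠ F \ insert r x := by
          intro e
          apply hx0
          apply eq_empty_of_forall_notMem; intro t ht
          have ht' := e ▸ ht
          exact (mem_sdiff.1 (e ▸ ht)).2 (mem_insert_of_mem ht)
        have three : 2 < #L := two_lt_card_iff.2 ⟨∅, x, F \ insert r x, h0L, hxL, hcL, fun e => hx0 e.symm, fun e => hc0 e.symm, hxc⟩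
        omega
  · -- at least two doubled members: non-degenerate, repaid in full by the strict hypothesis
    set P := posRainbow (F.erase r) (M ∩ N) with hP
    have hndA := not_degenerate_doubled_of_not_degenerate (𝒜 := 𝒜) (r := r) hnd
    have IHA := (IH (M ∩ N) h𝔄F hcf𝔄).2 hk hndA
    rw [card_rainbowMeets_of_not_degenerate hndA] at IHA
    rw [← hM, ← hN] at IHA
    rw [← hP] at IHA
    have hPtw := posRainbow_doubled_subset_twins F 𝒜 r hr
    have hB2 : 2 ≤ #(M ∪ N) := by omega
    by_cases hd : RainbowDegenerate (F.erase r) (M ∪ N)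
    · have h0P : (∅ : Finset α) ∉ P := hndA
      have hE : insert ∅ P ⊆ L.memberSubfamily r ∩ L.nonMemberSubfamily r := by
        intro Z hZ
        rcases mem_insert.1 hZ with rfl | hZ
        · exact twin0 hd
        · exact hPtw hZ
      have c1 := card_compress_add_card_twins_le F 𝒜 r (insert ∅ P) hE
      rw [← hM, ← hN, ← hL, card_insert_of_notMem h0P] at c1
      have := IHB.1; omega
    · have c1 := card_compress_add_card_twins_le F 𝒜 r P hPtw
      rw [← hM, ← hN, ← hL] at c1
      have := IHB.2 hB2 hd; omega

end Main

/-! ### 3. The reduction to the fully pinned degenerate residual -/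

/-- **REDUCTION THEOREM.**  The strict rainbow lemma — hence the rainbow lemma — follows from the residual statement, by induction on the ground
set: non-degenerate families are handled by `card_add_one_le_card_rainbowMeets_of_not_degenerate` at any point, degenerate families with an
unpinned point by `card_le_card_rainbowMeets_of_unpinned`, and the rest is the residual. [this work] -/
theorem rainbowStrict_of_pinnedResidual (hres : PinnedResidual α) : RainbowStrict α := by
  intro F
  induction' hn : #F using Nat.strong_induction_on with n ihn generalizing F
  have IH : ∀ r ∈ F, RainbowStrictOn (F.erase r) := fun r hr =>
    ihn #(F.erase r) (by rw [← hn]; exact card_erase_lt_of_mem hr) (F.erase r) rfl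
  intro 𝒞 h𝒞F hcf
  -- two distinct members force a point of `F`
  have hF : 2 ≤ #𝒞 → F.Nonempty := by
    intro h2
    rw [nonempty_iff_ne_empty]; rintro rfl
    obtain ⟨c, hc, d, hd, hcd⟩ := one_lt_card.1 h2
    exact hcd ((subset_empty.1 (h𝒞F c hc)).trans (subset_empty.1 (h𝒞F d hd)).symm)
  have strict : 2 ≤ #𝒞 → ¬ RainbowDegenerate F 𝒞 → #𝒞 + 1 ≤ #(rainbowMeets F 𝒞) := by
    intro h2 hnd
    obtain ⟨r, hr⟩ := hF h2
    exact card_add_one_le_card_rainbowMeets_of_not_degenerate hr h𝒞F hcf h2 hnd (IH r hr)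
  refine ⟨?_, strict⟩
  by_cases h2 : 2 ≤ #𝒞
  · by_cases hnd : RainbowDegenerate F 𝒞
    · by_cases hun : ∃ r ∈ F, ∀ b ∈ 𝒞.memberSubfamily r ∪ 𝒞.nonMemberSubfamily r,
          (F.erase r) \ b ∉ 𝒞.memberSubfamily r ∪ 𝒞.nonMemberSubfamily r
      · obtain ⟨r, hr, h𝔅⟩ := hun
        exact card_le_card_rainbowMeets_of_unpinned hr h𝒞F hcf h𝔅 (IH r hr)
      · push Not at hun
        exact hres F 𝒞 h𝒞F hcf hnd (fun r hr h => by obtain ⟨b, hb, hb'⟩ := hun r hr; exact h b hb hb') IH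
    · have := strict h2 hnd; omega
  · have : 0 < #(rainbowMeets F 𝒞) := card_pos.2 ⟨∅, mem_rainbowMeets_iff.2 (Or.inl rfl)⟩
    omega

/-- **The rainbow lemma follows from the residual statement.** [this work] -/
theorem rainbowMeetCojoin_of_pinnedResidual (hres : PinnedResidual α) : RainbowMeetCojoin α :=
  rainbowMeetCojoin_of_rainbowStrict (rainbowStrict_of_pinnedResidual hres)


end Summit.CriticalPhenomena.PercolationContinuityZ3.Theorems.SahiColouredDaykin
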